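import Summits.KontsevichZagierPeriods.KontsevichZagierPeriods.Theses.SymplecticScissors
import Literature.NumberTheory.Transcendental.AyoubPeriodSeries
import Literature.NumberTheory.Transcendental.AyoubPeriodSeriesKernel
import Literature.NumberTheory.Transcendental.AyoubPeriodSeriesPiAlgebraic
import Summits.KontsevichZagierPeriods.KontsevichZagierPeriods.Theorems.UnfoldedStokesStokesGenerationStubSpanToRepsAuxCoeff
import Mathlib.RingTheory.MvPowerSeries.Rename
import Mathlib.RingTheory.MvPowerSeries.Substitution
import Summits.KontsevichZagierPeriods.KontsevichZagierPeriods.Theorems.SymplecticScissorsTypeAGenerationStubRestrCOneAux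
import Summits.KontsevichZagierPeriods.KontsevichZagierPeriods.Theorems.SymplecticScissorsTypeAGenerationStubRestrCOne
import Summits.KontsevichZagierPeriods.KontsevichZagierPeriods.Theorems.SymplecticScissorsTypeAGenerationStubRescalePiece
import Summits.KontsevichZagierPeriods.KontsevichZagierPeriods.Theorems.SymplecticScissorsTypeAGenerationStubSubstRoom

/-!
# `TypeAGeneration` (stmt-KontsevichZagierPeriods-18392), line `Sketch`, stub
`stub_restrCZeroMemOan` (W4): the face map `G ↦ G|_{zᵢ=0}` preserves `𝒪_{k-alg}(𝔻̄^∞)`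

Registered stub `stub_restrCZeroMemOan` of the crux `TypeAGeneration` (route SymplecticScissors,
line `Sketch` = card stokes-compiler), on top of
`Literature/NumberTheory/Transcendental/AyoubPeriodSeries.lean` (`AyoubRel.Oan σ = 𝒪_{k-alg}(𝔻̄^∞)`:
power series in finitely many `zᵢ`, of polyradius `> 1`, algebraic over `k(z)`;
`AyoubRel.restrC i 0 = (·)|_{zᵢ=0}`), of the sibling stub files
`SymplecticScissorsTypeAGenerationStubRestrCOne(Aux).lean` (the face `zᵢ = 1`; `¬ UsesVar` of a
restriction), `SymplecticScissorsTypeAGenerationStubRescalePiece.lean` (`rescale 1[i ↦ c]`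
coefficientwise and on `C r`, `X l`; `polyToCSeries σ` on `C r`, `X l`) and
`SymplecticScissorsTypeAGenerationStubSubstRoom.lean` (non-negative weights).

At `zᵢ = 0` the face map is the **coefficient slice** `aᵢ = 0` (`s8_coeff_restrC_zero`:
`0⁰ = 1`, `0ⁿ⁺¹ = 0`), hence termwise dominated by `G` (polyradius, anisotropic weights `ρ ≥ 0`,
variables), and it is the ring endomorphism `rescale 1[i ↦ 0]` of all of `ℂ[[z]]`
(`s8_restrC_zero_eq_rescale`). **Algebraicity descends** as for `zᵢ = 1`, dividing by powers of `zᵢ`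
instead of `zᵢ - 1`: with `ev₀ : k[z] → k[z]`, `zᵢ ↦ 0`, a relation `P(G) = 0` restricts to
`(P.map ev₀)(G|_{zᵢ=0}) = 0` (`s8_restrC_zero_eval₂`), and some relation survives, `P.map ev₀ ≠ 0`
(`s8_descent`: otherwise `zᵢ` divides every coefficient of `P` — `ev₀ q = 0 ⟹ zᵢ ∣ q`,
`s8_X_dvd_sub_ev` — and `P = zᵢ P'` with `P'(G) = 0` and a leading coefficient of smaller total
degree).

Elementary (folklore); no definition is introduced (`ev₀` is written
`MvPolynomial.eval₂Hom C (Function.update X i 0)` throughout).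
-/

noncomputable section

-- `Summit.KontsevichZagierPeriods.KontsevichZagierPeriods.…` is the tree's mandated layout (single-conjunct summit).
set_option linter.dupNamespace false

namespace Summit.KontsevichZagierPeriods.KontsevichZagierPeriods.TypeAGenerationLine

open Finsupp MvPowerSeries
open Literature.NumberTheory.Transcendental
open Literature.NumberTheory.Transcendental.AyoubRel
open Summit.KontsevichZagierPeriods.KontsevichZagierPeriods.Theses.SymplecticScissors (TypeAGeneration)

/-! ## `G|_{zᵢ=0}` is the coefficient slice `aᵢ = 0` -/

/-- **Coefficient formula**: `coeff_a (G|_{zᵢ=0}) = [aᵢ = 0] coeff_a G` (`0⁰ = 1`, `0ⁿ⁺¹ = 0`).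
[folklore] -/
theorem s8_coeff_restrC_zero (i : ℕ) (G : CSeries) (a : ℕ →₀ ℕ) :
    coeff a (restrC i 0 G) = if a i = 0 then coeff a G else 0 := by
  rw [StokesGenerationLine.coeff_restrC]
  split_ifs with h
  · rw [tsum_eq_single 0]
    · rw [pow_zero, mul_one, single_zero, add_zero]
    · intro n hn
      rw [zero_pow hn, mul_zero]
  · rfl

/-- `‖coeff_a (G|_{zᵢ=0})‖ ≤ ‖coeff_a G‖`. [folklore] -/
theorem s8_norm_coeff_restrC_zero_le (i : ℕ) (G : CSeries) (a : ℕ →₀ ℕ) :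
    ‖coeff a (restrC i 0 G)‖ ≤ ‖coeff a G‖ := by
  rw [s8_coeff_restrC_zero]
  split_ifs
  · exact le_rfl
  · rw [norm_zero]
    exact norm_nonneg _

/-- `G|_{zᵢ=0}` involves only variables of `G`. [folklore] -/
theorem s8_usesVar_of_restrC_zero {i l : ℕ} {G : CSeries} (h : UsesVar (restrC i 0 G) l) :
    UsesVar G l := by
  obtain ⟨a, hal, hne⟩ := h
  rw [s8_coeff_restrC_zero] at hne
  split_ifs at hne with hai
  · exact ⟨a, hal, hne⟩
  · exact absurd rfl hne

/-- **Anisotropic weights `ρ ≥ 0` summable for `G` are summable for `G|_{zᵢ=0}`** (termwise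
domination). [folklore] -/
theorem s8_summable_weighted_restrC_zero {G : CSeries} {ρ : ℕ → ℝ} (hρ : ∀ l, 0 ≤ ρ l)
    (hs : Summable fun a : ℕ →₀ ℕ => ‖coeff a G‖ * a.prod fun l n => ρ l ^ n) (i : ℕ) :
    Summable fun a : ℕ →₀ ℕ => ‖coeff a (restrC i 0 G)‖ * a.prod fun l n => ρ l ^ n :=
  hs.of_nonneg_of_le (fun a => mul_nonneg (norm_nonneg _) (s3_wprod_nonneg hρ a)) fun a =>
    mul_le_mul_of_nonneg_right (s8_norm_coeff_restrC_zero_le i G a) (s3_wprod_nonneg hρ a)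

/-- **Polyradius `> 1` is preserved by the slice** (same radius, termwise domination). [folklore] -/
theorem s8_hasPolyradiusGtOne_restrC_zero {G : CSeries} (hG : HasPolyradiusGtOne G) (i : ℕ) :
    HasPolyradiusGtOne (restrC i 0 G) := by
  obtain ⟨r, hr, hs⟩ := hG
  have hr0 : 0 ≤ r := zero_le_one.trans hr.le
  exact ⟨r, hr, hs.of_nonneg_of_le (fun a => mul_nonneg (norm_nonneg _) (pow_nonneg hr0 _))
    fun a => mul_le_mul_of_nonneg_right (s8_norm_coeff_restrC_zero_le i G a) (pow_nonneg hr0 _)⟩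

/-! ## The slice is the ring endomorphism `rescale 1[i ↦ 0]` of `ℂ[[z]]` -/

/-- **`G|_{zᵢ=0} = rescale 1[i ↦ 0] G`** (coefficientwise `0^{aᵢ} G_a`): the slice is a ring
endomorphism of `ℂ[[z]]`. [folklore] -/
theorem s8_restrC_zero_eq_rescale (i : ℕ) (G : CSeries) :
    restrC i 0 G = rescale (Function.update (1 : ℕ → ℂ) i 0) G := by
  refine MvPowerSeries.ext fun a => ?_
  rw [s8_coeff_restrC_zero, s5_coeff_rescale]
  split_ifs with h
  · rw [h, pow_zero, one_mul]
  · rw [zero_pow h, zero_mul]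

/-- `(F + F')|_{zᵢ=0} = F|_{zᵢ=0} + F'|_{zᵢ=0}`. [folklore] -/
theorem s8_restrC_zero_add (i : ℕ) (F F' : CSeries) :
    restrC i 0 (F + F') = restrC i 0 F + restrC i 0 F' := by
  rw [s8_restrC_zero_eq_rescale, s8_restrC_zero_eq_rescale, s8_restrC_zero_eq_rescale, map_add]

/-- **Product rule** `(F F')|_{zᵢ=0} = F|_{zᵢ=0} · F'|_{zᵢ=0}` on all of `ℂ[[z]]` (at `aᵢ = 0` only
pairs `b + b' = a` with `bᵢ = b'ᵢ = 0` contribute). [folklore] -/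
theorem s8_restrC_zero_mul (i : ℕ) (F F' : CSeries) :
    restrC i 0 (F * F') = restrC i 0 F * restrC i 0 F' := by
  rw [s8_restrC_zero_eq_rescale, s8_restrC_zero_eq_rescale, s8_restrC_zero_eq_rescale, map_mul]

/-- `(C c)|_{zᵢ=0} = C c`. [folklore] -/
theorem s8_restrC_zero_C (i : ℕ) (c : ℂ) : restrC i 0 (C c : CSeries) = C c := by
  rw [s8_restrC_zero_eq_rescale, s5_rescale_C]

/-- `zᵢ|_{zᵢ=0} = 0`. [folklore] -/
theorem s8_restrC_zero_X_self (i : ℕ) : restrC i 0 (X i : CSeries) = 0 := by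
  rw [s8_restrC_zero_eq_rescale, s5_rescale_X, Function.update_self, map_zero, zero_mul]

/-- `z_l|_{zᵢ=0} = z_l` for `l ≠ i`. [folklore] -/
theorem s8_restrC_zero_X_of_ne {i l : ℕ} (h : l ≠ i) : restrC i 0 (X l : CSeries) = X l := by
  rw [s8_restrC_zero_eq_rescale, s5_rescale_X, Function.update_of_ne h, Pi.one_apply, map_one,
    one_mul]

/-! ## The evaluation `zᵢ ↦ 0` on `k[z]`; divisibility by `zᵢ`; descent -/

section Descent

variable (k : Type) [Field k]

/-- `ev₀` (`zᵢ ↦ 0`) fixes constants. [folklore] -/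
theorem s8_ev_C (i : ℕ) (r : k) :
    (MvPolynomial.eval₂Hom MvPolynomial.C (Function.update MvPolynomial.X i 0))
      (MvPolynomial.C r : MvPolynomial ℕ k) = MvPolynomial.C r :=
  MvPolynomial.eval₂Hom_C _ _ r

/-- `ev₀ zᵢ = 0`. [folklore] -/
theorem s8_ev_X_self (i : ℕ) :
    (MvPolynomial.eval₂Hom MvPolynomial.C (Function.update MvPolynomial.X i 0))
      (MvPolynomial.X i : MvPolynomial ℕ k) = 0 := by
  rw [MvPolynomial.eval₂Hom_X', Function.update_self]

/-- `ev₀ z_l = z_l` for `l ≠ i`. [folklore] -/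
theorem s8_ev_X_of_ne {i l : ℕ} (h : l ≠ i) :
    (MvPolynomial.eval₂Hom MvPolynomial.C (Function.update MvPolynomial.X i 0))
      (MvPolynomial.X l : MvPolynomial ℕ k) = MvPolynomial.X l := by
  rw [MvPolynomial.eval₂Hom_X', Function.update_of_ne h]

/-- **`zᵢ` divides `q - ev₀ q`** (induction on `q`: `z_l - ev₀ z_l ∈ {0, zᵢ}`). [folklore] -/
theorem s8_X_dvd_sub_ev (i : ℕ) (q : MvPolynomial ℕ k) :
    (MvPolynomial.X i : MvPolynomial ℕ k) ∣
      q - (MvPolynomial.eval₂Hom MvPolynomial.C (Function.update MvPolynomial.X i 0)) q := by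
  -- adapted from `s4_X_sub_one_dvd_sub_ev` (SymplecticScissorsTypeAGenerationStubRestrCOne.lean)
  induction q using MvPolynomial.induction_on with
  | C r =>
    rw [s8_ev_C, sub_self]
    exact dvd_zero _
  | add p q hp hq =>
    rw [map_add, add_sub_add_comm]
    exact dvd_add hp hq
  | mul_X p l hp =>
    rw [map_mul, MvPolynomial.eval₂Hom_X']
    have e : p * MvPolynomial.X l -
        (MvPolynomial.eval₂Hom MvPolynomial.C (Function.update MvPolynomial.X i 0)) p *
          Function.update MvPolynomial.X i 0 l =
        (p - (MvPolynomial.eval₂Hom MvPolynomial.C (Function.update MvPolynomial.X i 0)) p) *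
            MvPolynomial.X l +
          (MvPolynomial.eval₂Hom MvPolynomial.C (Function.update MvPolynomial.X i 0)) p *
            (MvPolynomial.X l - Function.update MvPolynomial.X i 0 l) := by
      ring
    rw [e]
    refine dvd_add (hp.mul_right _) (Dvd.dvd.mul_left ?_ _)
    by_cases h : l = i
    · rw [h, Function.update_self, sub_zero]
    · rw [Function.update_of_ne h, sub_self]
      exact dvd_zero _

variable {k} (σ : k →+* ℂ)

/-- **Descent of an algebraic relation through `zᵢ ↦ 0`.** If `G ∈ ℂ[[z]]` is algebraic over `k(z)`,
some relation `P(G) = 0` survives `ev₀`: `P.map ev₀ ≠ 0`. Take `P ≠ 0` with `P(G) = 0` minimising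
the total degree of the leading coefficient; if `P.map ev₀ = 0` then `zᵢ` divides every
coefficient, `P = C zᵢ · P'`, `P'(G) = 0` (`ℂ[[z]]` is a domain, `k[z] → ℂ[[z]]` is injective) and
the leading coefficient of `P'` has smaller total degree. [folklore] -/
theorem s8_descent {G : CSeries} (hG : IsAlgebraicOverRatFunc σ G) (i : ℕ) :
    ∃ P : Polynomial (MvPolynomial ℕ k),
      Polynomial.eval₂ (polyToCSeries σ) G P = 0 ∧
        P.map (MvPolynomial.eval₂Hom MvPolynomial.C (Function.update MvPolynomial.X i 0)) ≠ 0 := by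
  -- adapted from `s4_descent` (SymplecticScissorsTypeAGenerationStubRestrCOne.lean)
  classical
  have hex : ∃ n, ∃ P : Polynomial (MvPolynomial ℕ k), P ≠ 0 ∧
      Polynomial.eval₂ (polyToCSeries σ) G P = 0 ∧ P.leadingCoeff.totalDegree = n := by
    obtain ⟨P, hP, h0⟩ := hG
    exact ⟨_, P, hP, h0, rfl⟩
  obtain ⟨P, hP0, hPG, hdeg⟩ := Nat.find_spec hex
  refine ⟨P, hPG, fun hmap => ?_⟩
  have hp0 : (MvPolynomial.X i : MvPolynomial ℕ k) ≠ 0 := MvPolynomial.X_ne_zero i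
  -- every coefficient of `P` is divisible by `zᵢ`
  have hdvd : ∀ m, (MvPolynomial.X i : MvPolynomial ℕ k) ∣ P.coeff m := fun m => by
    have h := s8_X_dvd_sub_ev k i (P.coeff m)
    have h0 : (MvPolynomial.eval₂Hom MvPolynomial.C (Function.update MvPolynomial.X i 0))
        (P.coeff m) = 0 := by
      rw [← Polynomial.coeff_map, hmap, Polynomial.coeff_zero]
    rwa [h0, sub_zero] at h
  obtain ⟨P', hP'⟩ := (Polynomial.C_dvd_iff_dvd_coeff _ P).mpr hdvd
  have hP'0 : P' ≠ 0 := by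
    rintro rfl
    rw [mul_zero] at hP'
    exact hP0 hP'
  have hP'G : Polynomial.eval₂ (polyToCSeries σ) G P' = 0 := by
    have h := hPG
    rw [hP', Polynomial.eval₂_mul, Polynomial.eval₂_C, mul_eq_zero] at h
    exact h.resolve_left ((map_ne_zero_iff _ (polyToCSeries_injective σ)).mpr hp0)
  have hlt : P'.leadingCoeff.totalDegree < P.leadingCoeff.totalDegree := by
    rw [hP', Polynomial.leadingCoeff_mul, Polynomial.leadingCoeff_C,
      MvPolynomial.totalDegree_mul_of_isDomain hp0 (Polynomial.leadingCoeff_ne_zero.mpr hP'0),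
      MvPolynomial.totalDegree_X]
    omega
  rw [hdeg] at hlt
  exact Nat.find_min hex hlt ⟨P', hP'0, hP'G, rfl⟩

/-! ## The slice restricts polynomials by `ev₀`, and relations by `P ↦ P.map ev₀` -/

/-- **The slice restricts polynomials by `zᵢ ↦ 0`**, as ring homomorphisms `k[z] → ℂ[[z]]`:
`rescale 1[i ↦ 0] ∘ (q ↦ q(z)) = (q ↦ q(z)) ∘ ev₀` (both agree on `C r` and on the `z_l`).
[folklore] -/
theorem s8_rescale_comp_polyToCSeries (i : ℕ) :
    (rescale (Function.update (1 : ℕ → ℂ) i 0)).comp (polyToCSeries σ) =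
      (polyToCSeries σ).comp
        (MvPolynomial.eval₂Hom MvPolynomial.C (Function.update MvPolynomial.X i 0) :
          MvPolynomial ℕ k →+* MvPolynomial ℕ k) := by
  refine MvPolynomial.ringHom_ext (fun r => ?_) fun l => ?_
  · rw [RingHom.comp_apply, RingHom.comp_apply, s8_ev_C, s5_polyToCSeries_C,
      ← s8_restrC_zero_eq_rescale, s8_restrC_zero_C]
  · rw [RingHom.comp_apply, RingHom.comp_apply, s5_polyToCSeries_X, ← s8_restrC_zero_eq_rescale]
    by_cases h : l = i
    · rw [h, s8_restrC_zero_X_self, s8_ev_X_self, map_zero]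
    · rw [s8_restrC_zero_X_of_ne h, s8_ev_X_of_ne k h, s5_polyToCSeries_X]

/-- **Relations restrict**: `(P(G))|_{zᵢ=0} = (P.map ev₀)(G|_{zᵢ=0})` for every `G ∈ ℂ[[z]]` (the
slice is a ring endomorphism restricting the coefficients by `ev₀`). [folklore] -/
theorem s8_restrC_zero_eval₂ (i : ℕ) (G : CSeries) (P : Polynomial (MvPolynomial ℕ k)) :
    restrC i 0 (Polynomial.eval₂ (polyToCSeries σ) G P) =
      Polynomial.eval₂ (polyToCSeries σ) (restrC i 0 G)
        (P.map (MvPolynomial.eval₂Hom MvPolynomial.C (Function.update MvPolynomial.X i 0))) := by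
  rw [s8_restrC_zero_eq_rescale, Polynomial.hom_eval₂, s8_rescale_comp_polyToCSeries σ,
    Polynomial.eval₂_map, s8_restrC_zero_eq_rescale]

/-- **`G|_{zᵢ=0}` is algebraic over `k(z)`** for `G` algebraic over `k(z)` (descent + restriction of
the surviving relation; `0|_{zᵢ=0} = 0`). [folklore] -/
theorem s8_isAlgebraicOverRatFunc_restrC_zero {G : CSeries} (hG : IsAlgebraicOverRatFunc σ G)
    (i : ℕ) : IsAlgebraicOverRatFunc σ (restrC i 0 G) := by
  obtain ⟨P, hPG, hne⟩ := s8_descent σ hG i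
  refine ⟨P.map (MvPolynomial.eval₂Hom MvPolynomial.C (Function.update MvPolynomial.X i 0)), hne,
    ?_⟩
  rw [← s8_restrC_zero_eval₂ σ i G P, hPG, restrC_zero]

end Descent

/-! ## Registered form -/

/-- **W4 — the face map `G ↦ G|_{zᵢ=0}` preserves `𝒪_{k-alg}(𝔻̄^∞)`, variables and weights.**
For `G ∈ 𝒪_{k-alg}(𝔻̄^∞)`: `G|_{zᵢ=0} ∈ 𝒪_{k-alg}(𝔻̄^∞)` (the face map at `zᵢ = 0` is the
coefficient slice `aᵢ = 0`, a ring endomorphism of `ℂ[[z]]`, so an algebraic relation `P(z, G) = 0`,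
first divided by the exact power of `zᵢ` dividing all its coefficients, restricts to a non-trivial
relation for `G|_{zᵢ=0}`); it does not involve `zᵢ`, involves only variables of `G`, has the
coefficients `[aᵢ = 0] G_a`, and anisotropic weights `ρ ≥ 0` summable for `G` are summable for
`G|_{zᵢ=0}` (termwise domination). [folklore] -/
theorem stub_restrCZeroMemOan :
    ∀ (k : Type) [Field k] [CharZero k] (σ : k →+* ℂ) (G : CSeries), G ∈ Oan σ → ∀ (i : ℕ),
      restrC i 0 G ∈ Oan σ ∧ ¬ UsesVar (restrC i 0 G) i ∧
      (∀ l : ℕ, UsesVar (restrC i 0 G) l → UsesVar G l) ∧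
      (∀ a : ℕ →₀ ℕ, MvPowerSeries.coeff a (restrC i 0 G) =
        if a i = 0 then MvPowerSeries.coeff a G else 0) ∧
      (∀ ρ : ℕ → ℝ, (∀ l, 0 ≤ ρ l) →
        Summable (fun a : ℕ →₀ ℕ => ‖MvPowerSeries.coeff a G‖ * a.prod fun l n => ρ l ^ n) →
        Summable (fun a : ℕ →₀ ℕ =>
          ‖MvPowerSeries.coeff a (restrC i 0 G)‖ * a.prod fun l n => ρ l ^ n)) := by
  intro k _ _ σ G hG i
  refine ⟨⟨?_, s8_hasPolyradiusGtOne_restrC_zero hG.2.1 i,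
      s8_isAlgebraicOverRatFunc_restrC_zero σ hG.2.2 i⟩,
    s4_not_usesVar_restrC i 0 G, fun l hl => s8_usesVar_of_restrC_zero hl,
    fun a => s8_coeff_restrC_zero i G a, fun ρ hρ hs => s8_summable_weighted_restrC_zero hρ hs i⟩
  obtain ⟨m, hm⟩ := hG.1
  exact ⟨m, StokesGenerationLine.dependsOnlyOnLT_restrC i 0 hm⟩

end Summit.KontsevichZagierPeriods.KontsevichZagierPeriods.TypeAGenerationLine
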